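import Literature.NumberTheory.Rogawski1990.ArchOrbFamGExtBoxDescent           -- ★ p851016 (LH3-p04 (g4)): (B-desc) at generic face points; brings the house frame, `orbFamG`, `orbFamGExt`, `InRegG`, `RegG`, `slotSign`, `HcSemireg`
import Literature.NumberTheory.Rogawski1990.ArchOrbFamGExtRealWallContinuous    -- ★ (LH5-p03): GLUE `hcExtendG_eqOn_of_continuousOn` (the dock `RegG → InRegG`)
import Literature.NumberTheory.Automorphic.ArchEndoscopicChartOrbitalContinuity   -- ★ `isCompact_setOf_exists_conj_endoBlock_mem_of_not_mem`; brings ★ `endoBlock`, `archLocal`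
import Literature.NumberTheory.Automorphic.ArchRankOneJumpZeroCone                -- ★ `cayley_conj_circleDiagonal_mem_of_eq_over`, `isClosedEmbedding_coe_unitaryGroupOfForm_of_eq_over`
import Literature.NumberTheory.Automorphic.ArchCartanCoordinates                  -- ★ `continuous_circleExp_coord`
import HarnessLib

/-!
# (B-desc′) box descent of the EXTENDED genuine family at NON-GENERIC face points, on `U ∩ InRegG` — the MODEL'S CONTINUITY off the wall and the ASSEMBLY (dock `U ∩ RegG S → U ∩ InRegG`)
# (Rogawski 1990 §8.2; Harish-Chandra's compactness lemma; Varadarajan 1977 I §1.12 «`'F_f` extends continuously across the compact and real walls»)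

Topic `NumberTheory/Rogawski1990`; namespace `Literature.NumberTheory.Rogawski1990`.  THEOREMS ONLY (no `def`, no instance, no notation, no axiom, no named fact, no `sorry`);
kernel lane `--kind proof --supports stmt-HodgeConjecture-24833`.  Cell `pub/hodgecm-mathlib`, crux H413 (`stmt-HodgeConjecture-24833`), F0∕P3c line LH3 (closer stub `stub_N9`),
LETTER L1 clause (I₁) «bounded jets on `K ∩ InRegG`», LH3-plan (g3) RULING #17 brick **(B-desc′) «NON-GENERIC FACE POINTS»** (signature: (I₁) spec-owner LH7-p04 (g4),
`F0/P3c/LH7/LH7-p04/g4/ArchOrbFamGExtBoxDescentInRegG.sigfirst.v1.lean` 53d7ced29978e22f; proof holder LH7-p02 (g4); the (H-core) half — the descent identity for the RAW member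
`orbFamG` at the `G`-regular points of the box, with the jointly smooth block family `f` — is LH5-p02 (g4)'s sequel over ★ (A4′) p851133 and lands as EDITION 2's import).

THE MATHEMATICS.  At a NON-GENERIC face point `x` (one noncompact coincidence `x_{w₀0} = x_{w₀2}` at the covered compact place `w₀`, third eigenvalue off it; compact coincidences at the
other compact places and anything at the split places ALLOWED) the nearby points off the `w₀`-wall lie in `InRegG ∖ RegG` in general (compact walls, real walls, scalar split points of
the OTHER places), where the extended family ★ `orbFamGExt` is the `RegG`-LIMIT of the raw member (★ `hcExtendG`).  So the (B-desc′) identity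
`orbFamGExt … S c = Φ₀(c) · K · ∫_{U(J)} f(c, ↑↑(h T(c) h⁻¹)) dμ₀(h)` (`Φ₀` = the three signed `w₀`-root factors of ★ `archRG`, `T(c) = P diag(e^{ic_{w₀0}}, e^{ic_{w₀2}}) P⁻¹` the Cayley
torus point of the abstract split-form group `U(J)(ℂ)`, `J = (StdForm.antidiagonal 2).over ℂ`) on `U ∩ {off the w₀-wall}` is EXACTLY: (H-core) the same identity for the raw `orbFamG` at
the `G`-REGULAR points of the box + (H-cont) continuity of the model off the `w₀`-wall + the dock ★ `hcExtendG_eqOn_of_continuousOn` (★ `RegG S` is dense; the value at a wall point of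
`InRegG` IS the limit).  This file proves (H-cont) for EVERY jointly continuous, uniformly compactly `X`-supported `f` and assembles.
* §1 **`isCompact_setOf_exists_conj_cayleyTorus_mem`** — compact conjugating set over a compact arc of REGULAR Cayley torus points, abstract `J` (★
  `isCompact_setOf_exists_conj_endoBlock_mem_of_not_mem` on `archLocal L 2 Φ₂ w₀`, whose `endoBlock L ∅ c w₀` IS `T(c)`, transported along `J = σ_{w₀}(Φ₂)` — ★ `antidiagOne_map`, ★
  `StdForm.over_antidiagonal_eq`; `U(J) ↪ M₂(ℂ)` closed, ★ `isClosedEmbedding_coe_unitaryGroupOfForm_of_eq_over`).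
* §2 `continuous_cayleyTorus`, **`continuousOn_integral_conj_cayleyTorus`** — the model `c ↦ ∫ f(c, ↑↑(h T(c) h⁻¹)) dμ₀` is continuous on `{e^{ic_{w₀0}} ≠ e^{ic_{w₀2}}}` (Mathlib
  `continuousOn_integral_of_compact_support` on a ball, §1 for the locally uniform `h`-support).
* §3 `continuous_wallRootFactors`, **`continuousOn_boxModel`** = (H-cont) VERBATIM.
* §4 **`exists_descent_box_orbFamGExt_inRegG_of_core`** (THE DOCK: (H-core) + (H-cont) ⇒ the signature's eight clauses for `orbFamGExt`), **`exists_descent_box_orbFamGExt_inRegG_of_corePackage`**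
  ((H-core) delivered as ONE `∃ K U f` package ⇒ the signature's conclusion; (H-cont) discharged by §3), `hcSemireg_base_point` ((F₀) ⊆ (F): a generic `HcSemireg` face point satisfies the
  (B-desc′) base-point hypotheses).  EDITION 2 (append-only): the HEAD `exists_descent_box_orbFamGExt_inRegG` := §4 ∘ (H-core).
HONEST LABEL: HC_CM is proved only modulo the 7 printed citations (2 remaining: hLiu418 = `stmt-HodgeConjecture-24832`, h413 = `stmt-HodgeConjecture-24833`) until rung 0 closes;
count-neutral letter-L1 (I₁) plumbing (pays nothing by itself).

## References
* [Rogawski1990] J. D. Rogawski, *Automorphic Representations of Unitary Groups in Three Variables*, Ann. of Math. Stud. 123 (1990), §4.12 Lemma 4.12.1 p. 66, §8.2 pp. 118–124.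
* [Varadarajan1977] V. S. Varadarajan, *Harmonic Analysis on Real Reductive Groups*, LNM 576 (1977), Part I §1.12.
* [Bouaziz1994IntegralesOrbitales] A. Bouaziz, *Intégrales orbitales sur les groupes de Lie réductifs*, Ann. Sci. ÉNS 27 (1994), §3.1–3.2 pp. 579–580.
* [Shelstad1979] D. Shelstad, *Characters and inner forms of a quasi-split group over ℝ*, Compositio Math. 39 (1979), §4 Lemma 4.3 (p. 25).
* [DeitmarEchterhoff2014] A. Deitmar, S. Echterhoff, *Principles of Harmonic Analysis*, 2nd ed. (2014), Lemma 9.3.3.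
-/

set_option autoImplicit false

noncomputable section

open MeasureTheory MeasureTheory.Measure NumberField NumberField.InfinitePlace Matrix Complex Set Filter Topology
open scoped MatrixGroups Matrix Classical ContDiff Matrix.Norms.Operator
open Literature.NumberTheory.Automorphic Literature.NumberTheory.Automorphic.UnitaryGroup Literature.NumberTheory.Automorphic.ArchCartan

namespace Literature.NumberTheory.Rogawski1990

section Cont

variable (L : Type) [Field L] [NumberField L] (w₀ : {w : InfinitePlace L // IsComplex w})

/-! ## §1 Compactness of the conjugating set over a compact regular arc of Cayley torus points, abstract `J` -/

/-- **COMPACT CONJUGATING SET, abstract `J`**: for `J = (StdForm.antidiagonal 2).over ℂ`, a compact set `K` of coordinates with `e^{i c_{w₀0}} ≠ e^{i c_{w₀2}}` on `K`, and a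
compact `C ⊆ M₂(ℂ)`, the set `{y ∈ U(J)(ℂ) | ∃ c ∈ K, ↑↑(y · T(c) · y⁻¹) ∈ C}` (`T(c) = P diag(e^{i c_{w₀0}}, e^{i c_{w₀2}}) P⁻¹`) is compact — ★
`isCompact_setOf_exists_conj_endoBlock_mem_of_not_mem` on `archLocal L 2 Φ₂ w₀`, whose `endoBlock L ∅ c w₀` IS `T(c)`, transported along `J = σ_{w₀}(Φ₂)`.
[cite: Rogawski1990, §8.2 p. 122] [cite: DeitmarEchterhoff2014, Lemma 9.3.3] -/
theorem isCompact_setOf_exists_conj_cayleyTorus_mem {J : Matrix (Fin 2) (Fin 2) ℂ} (hJ : J = (StdForm.antidiagonal 2).over ℂ)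
    {K : Set ({w : InfinitePlace L // IsComplex w} → Fin 3 → ℝ)} (hK : IsCompact K) (hKreg : ∀ c ∈ K, Circle.exp (c w₀ 0) ≠ Circle.exp (c w₀ 2))
    {C : Set (Matrix (Fin 2) (Fin 2) ℂ)} (hC : IsCompact C) :
    IsCompact {y : ↥(unitaryGroupOfForm (starRingEnd ℂ) J) | ∃ c ∈ K,
      (((y * ⟨Matrix.GeneralLinearGroup.mkOfDetNeZero !![(1 : ℂ), 1; 1, -1] det_cayleyTwo_ne_zero *
              circleDiagonal 2 ![Circle.exp (c w₀ 0), Circle.exp (c w₀ 2)] *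
              (Matrix.GeneralLinearGroup.mkOfDetNeZero !![(1 : ℂ), 1; 1, -1] det_cayleyTwo_ne_zero)⁻¹,
            cayley_conj_circleDiagonal_mem_of_eq_over hJ _⟩ * y⁻¹ : ↥(unitaryGroupOfForm (starRingEnd ℂ) J)) : GL (Fin 2) ℂ) : Matrix (Fin 2) (Fin 2) ℂ) ∈ C} := by
  obtain rfl : J = (Matrix.of fun i j : Fin 2 => if i.val + j.val + 1 = 2 then (1 : L) else 0).map w₀.1.embedding := by
    rw [hJ, Literature.NumberTheory.Rogawski1990.antidiagOne_map, StdForm.over_antidiagonal_eq]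
  have hce := isClosedEmbedding_coe_unitaryGroupOfForm_of_eq_over hJ
  have h := isCompact_setOf_exists_conj_endoBlock_mem_of_not_mem L w₀ ∅ (Finset.notMem_empty w₀) hK hKreg (hce.isCompact_preimage hC)
  have hT : ∀ c : {w : InfinitePlace L // IsComplex w} → Fin 3 → ℝ, endoBlock L ∅ c w₀ =
      ⟨Matrix.GeneralLinearGroup.mkOfDetNeZero !![(1 : ℂ), 1; 1, -1] det_cayleyTwo_ne_zero *
          circleDiagonal 2 ![Circle.exp (c w₀ 0), Circle.exp (c w₀ 2)] *
          (Matrix.GeneralLinearGroup.mkOfDetNeZero !![(1 : ℂ), 1; 1, -1] det_cayleyTwo_ne_zero)⁻¹,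
        cayley_conj_circleDiagonal_mem_of_eq_over hJ _⟩ := by
    intro c
    unfold endoBlock
    rw [if_neg (Finset.notMem_empty w₀)]
  simp_rw [hT] at h
  exact h

/-! ## §2 The model is continuous off the wall -/

omit [NumberField L] in
/-- The Cayley torus point `c ↦ T(c) ∈ U(J)` depends continuously on the coordinates. [cite: Rogawski1990, §8.2 p. 122] -/
theorem continuous_cayleyTorus {J : Matrix (Fin 2) (Fin 2) ℂ} (hJ : J = (StdForm.antidiagonal 2).over ℂ) :
    Continuous fun c : {w : InfinitePlace L // IsComplex w} → Fin 3 → ℝ =>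
      (⟨Matrix.GeneralLinearGroup.mkOfDetNeZero !![(1 : ℂ), 1; 1, -1] det_cayleyTwo_ne_zero *
          circleDiagonal 2 ![Circle.exp (c w₀ 0), Circle.exp (c w₀ 2)] *
          (Matrix.GeneralLinearGroup.mkOfDetNeZero !![(1 : ℂ), 1; 1, -1] det_cayleyTwo_ne_zero)⁻¹,
        cayley_conj_circleDiagonal_mem_of_eq_over hJ _⟩ : ↥(unitaryGroupOfForm (starRingEnd ℂ) J)) := by
  refine Continuous.subtype_mk ?_ _
  have h2 : Continuous fun c : {w : InfinitePlace L // IsComplex w} → Fin 3 → ℝ => (![Circle.exp (c w₀ 0), Circle.exp (c w₀ 2)] : Fin 2 → Circle) := by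
    refine continuous_pi fun i => ?_
    fin_cases i
    · simpa using continuous_circleExp_coord w₀ 0
    · simpa using continuous_circleExp_coord w₀ 2
  exact (continuous_const.mul ((continuous_circleDiagonal 2).comp h2)).mul continuous_const

/-- **THE MODEL IS CONTINUOUS OFF THE `w₀`-WALL**: for `f : (coordinates) × M₂(ℂ) → E` jointly continuous and vanishing off one compact set of matrices, and any measure `μ₀`
finite on compacts on `U(J)(ℂ)`, `c ↦ ∫ f(c, ↑↑(h T(c) h⁻¹)) dμ₀(h)` is continuous on `{c | e^{i c_{w₀0}} ≠ e^{i c_{w₀2}}}` (Mathlib `continuousOn_integral_of_compact_support` on a ball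
around each point, §1 for the uniform compact `h`-support there). [cite: Rogawski1990, §8.2 p. 122] [cite: Varadarajan1977, I §1.12] -/
theorem continuousOn_integral_conj_cayleyTorus {J : Matrix (Fin 2) (Fin 2) ℂ} (hJ : J = (StdForm.antidiagonal 2).over ℂ)
    [MeasurableSpace ↥(unitaryGroupOfForm (starRingEnd ℂ) J)] [BorelSpace ↥(unitaryGroupOfForm (starRingEnd ℂ) J)]
    (μ₀ : Measure ↥(unitaryGroupOfForm (starRingEnd ℂ) J)) [IsFiniteMeasureOnCompacts μ₀]
    {E : Type*} [NormedAddCommGroup E] [NormedSpace ℝ E]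
    (f : ({w : InfinitePlace L // IsComplex w} → Fin 3 → ℝ) × Matrix (Fin 2) (Fin 2) ℂ → E) (hf : Continuous f)
    (hfC : ∃ C : Set (Matrix (Fin 2) (Fin 2) ℂ), IsCompact C ∧ ∀ c X, X ∉ C → f (c, X) = 0) :
    ContinuousOn (fun c : {w : InfinitePlace L // IsComplex w} → Fin 3 → ℝ =>
        ∫ h : ↥(unitaryGroupOfForm (starRingEnd ℂ) J),
          f (c, (((h * ⟨Matrix.GeneralLinearGroup.mkOfDetNeZero !![(1 : ℂ), 1; 1, -1] det_cayleyTwo_ne_zero *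
                circleDiagonal 2 ![Circle.exp (c w₀ 0), Circle.exp (c w₀ 2)] *
                (Matrix.GeneralLinearGroup.mkOfDetNeZero !![(1 : ℂ), 1; 1, -1] det_cayleyTwo_ne_zero)⁻¹,
              cayley_conj_circleDiagonal_mem_of_eq_over hJ _⟩ * h⁻¹ : ↥(unitaryGroupOfForm (starRingEnd ℂ) J)) : GL (Fin 2) ℂ) : Matrix (Fin 2) (Fin 2) ℂ)) ∂μ₀)
      {c | Circle.exp (c w₀ 0) ≠ Circle.exp (c w₀ 2)} := by
  obtain ⟨C, hC, hfC⟩ := hfC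
  have hO : IsOpen {c : {w : InfinitePlace L // IsComplex w} → Fin 3 → ℝ | Circle.exp (c w₀ 0) ≠ Circle.exp (c w₀ 2)} :=
    isOpen_ne_fun (continuous_circleExp_coord w₀ 0) (continuous_circleExp_coord w₀ 2)
  have hce := isClosedEmbedding_coe_unitaryGroupOfForm_of_eq_over hJ
  have hT := continuous_cayleyTorus L w₀ hJ
  -- the integrand is jointly continuous in `(c, h)`
  have hF : Continuous fun p : ({w : InfinitePlace L // IsComplex w} → Fin 3 → ℝ) × ↥(unitaryGroupOfForm (starRingEnd ℂ) J) =>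
      f (p.1, (((p.2 * ⟨Matrix.GeneralLinearGroup.mkOfDetNeZero !![(1 : ℂ), 1; 1, -1] det_cayleyTwo_ne_zero *
            circleDiagonal 2 ![Circle.exp (p.1 w₀ 0), Circle.exp (p.1 w₀ 2)] *
            (Matrix.GeneralLinearGroup.mkOfDetNeZero !![(1 : ℂ), 1; 1, -1] det_cayleyTwo_ne_zero)⁻¹,
          cayley_conj_circleDiagonal_mem_of_eq_over hJ _⟩ * p.2⁻¹ : ↥(unitaryGroupOfForm (starRingEnd ℂ) J)) : GL (Fin 2) ℂ) : Matrix (Fin 2) (Fin 2) ℂ)) :=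
    hf.comp (continuous_fst.prodMk (hce.continuous.comp ((continuous_snd.mul (hT.comp continuous_fst)).mul continuous_snd.inv)))
  intro c₀ hc₀
  obtain ⟨r, hr, hball⟩ := Metric.isOpen_iff.1 hO c₀ hc₀
  have hN : IsCompact (Metric.closedBall c₀ (r / 2)) := isCompact_closedBall c₀ (r / 2)
  have hNreg : ∀ c ∈ Metric.closedBall c₀ (r / 2), Circle.exp (c w₀ 0) ≠ Circle.exp (c w₀ 2) :=
    fun c hc => hball (Metric.closedBall_subset_ball (by linarith) hc)
  have hk := isCompact_setOf_exists_conj_cayleyTorus_mem L w₀ hJ hN hNreg hC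
  have hloc : ContinuousOn (fun c : {w : InfinitePlace L // IsComplex w} → Fin 3 → ℝ =>
        ∫ h : ↥(unitaryGroupOfForm (starRingEnd ℂ) J),
          f (c, (((h * ⟨Matrix.GeneralLinearGroup.mkOfDetNeZero !![(1 : ℂ), 1; 1, -1] det_cayleyTwo_ne_zero *
                circleDiagonal 2 ![Circle.exp (c w₀ 0), Circle.exp (c w₀ 2)] *
                (Matrix.GeneralLinearGroup.mkOfDetNeZero !![(1 : ℂ), 1; 1, -1] det_cayleyTwo_ne_zero)⁻¹,
              cayley_conj_circleDiagonal_mem_of_eq_over hJ _⟩ * h⁻¹ : ↥(unitaryGroupOfForm (starRingEnd ℂ) J)) : GL (Fin 2) ℂ) : Matrix (Fin 2) (Fin 2) ℂ)) ∂μ₀)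
      (Metric.ball c₀ (r / 2)) := by
    refine continuousOn_integral_of_compact_support hk hF.continuousOn ?_
    intro c h hc hh
    apply hfC
    intro hmem
    exact hh ⟨c, Metric.ball_subset_closedBall hc, hmem⟩
  exact (hloc.continuousAt (Metric.ball_mem_nhds c₀ (half_pos hr))).continuousWithinAt

/-! ## §3 The box model of the (B-desc′) assembly is continuous off the wall -/

omit [NumberField L] in
/-- The three signed `w₀`-root factors `(1 − e^{i(c_{w₀1}−c_{w₀0})})(1 − e^{i(c_{w₀2}−c_{w₀0})})(1 − e^{i(c_{w₀2}−c_{w₀1})})` depend continuously on `c`. [cite: Rogawski1990, §8.2 p. 118] -/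
theorem continuous_wallRootFactors :
    Continuous fun c : {w : InfinitePlace L // IsComplex w} → Fin 3 → ℝ =>
      (1 - (Circle.exp (c w₀ 1 - c w₀ 0) : ℂ)) * (1 - (Circle.exp (c w₀ 2 - c w₀ 0) : ℂ)) * (1 - (Circle.exp (c w₀ 2 - c w₀ 1) : ℂ)) := by
  have hc : ∀ i j : Fin 3, Continuous fun c : {w : InfinitePlace L // IsComplex w} → Fin 3 → ℝ => (Circle.exp (c w₀ i - c w₀ j) : ℂ) := fun i j =>
    continuous_subtype_val.comp (Circle.exp.continuous.comp ((continuous_apply_apply w₀ i).sub (continuous_apply_apply w₀ j)))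
  exact ((continuous_const.sub (hc 1 0)).mul (continuous_const.sub (hc 2 0))).mul (continuous_const.sub (hc 2 1))

/-- **(H-cont) THE BOX MODEL IS CONTINUOUS OFF THE WALL** — VERBATIM the hypothesis `hcont` of the (B-desc′) assembly `exists_descent_box_orbFamGExt_inRegG_of_core`: for `f` jointly
smooth (continuity is what is used) and vanishing off one compact set of matrices, `c ↦ Φ₀(c) · (K · ∫_{U(J)} f(c, ↑↑(h T(c) h⁻¹)) dμ₀)` is continuous on `U ∩ {e^{ic_{w₀0}} ≠ e^{ic_{w₀2}}}`
for every `U` and every constant `K`. [cite: Rogawski1990, §8.2 p. 122] [cite: Varadarajan1977, I §1.12] -/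
theorem continuousOn_boxModel {J : Matrix (Fin 2) (Fin 2) ℂ} (hJ : J = (StdForm.antidiagonal 2).over ℂ)
    [MeasurableSpace ↥(unitaryGroupOfForm (starRingEnd ℂ) J)] [BorelSpace ↥(unitaryGroupOfForm (starRingEnd ℂ) J)]
    (μ₀ : Measure ↥(unitaryGroupOfForm (starRingEnd ℂ) J)) [IsFiniteMeasureOnCompacts μ₀]
    (U : Set ({w : InfinitePlace L // IsComplex w} → Fin 3 → ℝ))
    (f : ({w : InfinitePlace L // IsComplex w} → Fin 3 → ℝ) × Matrix (Fin 2) (Fin 2) ℂ → ℂ) (hf : ContDiff ℝ ∞ f)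
    (hfC : ∃ C : Set (Matrix (Fin 2) (Fin 2) ℂ), IsCompact C ∧ ∀ c X, X ∉ C → f (c, X) = 0) (K : ℂ) :
    ContinuousOn (fun c : {w : InfinitePlace L // IsComplex w} → Fin 3 → ℝ =>
        (1 - (Circle.exp (c w₀ 1 - c w₀ 0) : ℂ)) * (1 - (Circle.exp (c w₀ 2 - c w₀ 0) : ℂ)) * (1 - (Circle.exp (c w₀ 2 - c w₀ 1) : ℂ)) *
        (K * ∫ h : ↥(unitaryGroupOfForm (starRingEnd ℂ) J),
          f (c, (((h * ⟨Matrix.GeneralLinearGroup.mkOfDetNeZero !![(1 : ℂ), 1; 1, -1] det_cayleyTwo_ne_zero *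
                circleDiagonal 2 ![Circle.exp (c w₀ 0), Circle.exp (c w₀ 2)] *
                (Matrix.GeneralLinearGroup.mkOfDetNeZero !![(1 : ℂ), 1; 1, -1] det_cayleyTwo_ne_zero)⁻¹,
              cayley_conj_circleDiagonal_mem_of_eq_over hJ _⟩ * h⁻¹ : ↥(unitaryGroupOfForm (starRingEnd ℂ) J)) : GL (Fin 2) ℂ) : Matrix (Fin 2) (Fin 2) ℂ)) ∂μ₀))
      (U ∩ {c | Circle.exp (c w₀ 0) ≠ Circle.exp (c w₀ 2)}) :=
  ((continuous_wallRootFactors L w₀).continuousOn.mul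
    (continuousOn_const.mul ((continuousOn_integral_conj_cayleyTorus L w₀ hJ μ₀ f hf.continuous hfC).mono inter_subset_right)))

end Cont

/-! ## §4 The assembly: the dock `U ∩ RegG S → U ∩ InRegG` -/

section Assembly

open Literature.NumberTheory.GaloisRepresentations
open scoped Real

variable (L : Type) [Field L] [NumberField L] [IsCMField L] (α : Fin 3 → L)
  [MeasurableSpace ↥(arch (↥(maximalRealSubfield L)) L (IsCMField.complexConj L) 3 (Matrix.diagonal α))]
  [BorelSpace ↥(arch (↥(maximalRealSubfield L)) L (IsCMField.complexConj L) 3 (Matrix.diagonal α))]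
  (ν' : Measure ↥(arch (↥(maximalRealSubfield L)) L (IsCMField.complexConj L) 3 (Matrix.diagonal α))) [ν'.IsHaarMeasure] [ν'.IsMulRightInvariant]

/-- **(B-desc′) ASSEMBLY — THE DOCK.**  If, on an open box `U ∋ x` whose only noncompact wall is the `w₀`-wall (clause 7), the RAW member `orbFamG L α ν′ a′ S` satisfies the descent
identity `orbFamG … S c = Φ₀(c) · K · ∫_{U(J)} f(c, h T(c) h⁻¹) dμ₀` at every `G`-REGULAR `c ∈ U` (H-core), and the model is continuous on `U` off the `w₀`-wall (H-cont), then the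
EXTENDED family `orbFamGExt … S` satisfies the same identity at EVERY `c ∈ U` off the `w₀`-wall (compact walls of the other places and real walls ∕ scalar split points included):
★ `hcExtendG_eqOn_of_continuousOn` — the wall points of `U ∩ InRegG` are `RegG`-limits (★ `dense_regG`) and the value there IS the limit.
[cite: Varadarajan1977, I §1.12] [cite: Bouaziz1994IntegralesOrbitales, §3.1 (I₁)–(I₂) p. 579] [cite: Shelstad1979, §4 Lemma 4.3 (p. 25)] -/
theorem exists_descent_box_orbFamGExt_inRegG_of_core
    {J : Matrix (Fin 2) (Fin 2) ℂ} (hJ : J = (StdForm.antidiagonal 2).over ℂ)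
    [MeasurableSpace ↥(unitaryGroupOfForm (starRingEnd ℂ) J)] [BorelSpace ↥(unitaryGroupOfForm (starRingEnd ℂ) J)]
    (μ₀ : Measure ↥(unitaryGroupOfForm (starRingEnd ℂ) J))
    {S : Finset {w : InfinitePlace L // IsComplex w}} {w₀ : {w : InfinitePlace L // IsComplex w}} {x : {w : InfinitePlace L // IsComplex w} → Fin 3 → ℝ}
    {a' : ↥(arch (↥(maximalRealSubfield L)) L (IsCMField.complexConj L) 3 (Matrix.diagonal α)) → ℂ}
    {K : ℂ} {U : Set ({w : InfinitePlace L // IsComplex w} → Fin 3 → ℝ)} {f : ({w : InfinitePlace L // IsComplex w} → Fin 3 → ℝ) × Matrix (Fin 2) (Fin 2) ℂ → ℂ}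
    (hK : K ≠ 0) (hUo : IsOpen U) (hxU : x ∈ U) (hf : ContDiff ℝ ∞ f)
    (hfC : ∃ C : Set (Matrix (Fin 2) (Fin 2) ℂ), IsCompact C ∧ ∀ c X, X ∉ C → f (c, X) = 0)
    (hft : ∀ c X, f (c, X) = f (Function.update c w₀ ![0, c w₀ 1, 0], X))
    (hU7 : ∀ c ∈ U, Circle.exp (c w₀ 0) ≠ Circle.exp (c w₀ 2) → c ∈ InRegG (slotSign L α) S)
    (hcore : ∀ c ∈ U, c ∈ RegG S →
        orbFamG L α ν' a' S c =
          (1 - (Circle.exp (c w₀ 1 - c w₀ 0) : ℂ)) * (1 - (Circle.exp (c w₀ 2 - c w₀ 0) : ℂ)) * (1 - (Circle.exp (c w₀ 2 - c w₀ 1) : ℂ)) *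
          (K * ∫ h : ↥(unitaryGroupOfForm (starRingEnd ℂ) J),
            f (c, (((h * ⟨Matrix.GeneralLinearGroup.mkOfDetNeZero !![(1 : ℂ), 1; 1, -1] det_cayleyTwo_ne_zero *
                  circleDiagonal 2 ![Circle.exp (c w₀ 0), Circle.exp (c w₀ 2)] *
                  (Matrix.GeneralLinearGroup.mkOfDetNeZero !![(1 : ℂ), 1; 1, -1] det_cayleyTwo_ne_zero)⁻¹,
                cayley_conj_circleDiagonal_mem_of_eq_over hJ _⟩ * h⁻¹ : ↥(unitaryGroupOfForm (starRingEnd ℂ) J)) : GL (Fin 2) ℂ) : Matrix (Fin 2) (Fin 2) ℂ)) ∂μ₀))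
    (hcont : ContinuousOn (fun c : {w : InfinitePlace L // IsComplex w} → Fin 3 → ℝ =>
          (1 - (Circle.exp (c w₀ 1 - c w₀ 0) : ℂ)) * (1 - (Circle.exp (c w₀ 2 - c w₀ 0) : ℂ)) * (1 - (Circle.exp (c w₀ 2 - c w₀ 1) : ℂ)) *
          (K * ∫ h : ↥(unitaryGroupOfForm (starRingEnd ℂ) J),
            f (c, (((h * ⟨Matrix.GeneralLinearGroup.mkOfDetNeZero !![(1 : ℂ), 1; 1, -1] det_cayleyTwo_ne_zero *
                  circleDiagonal 2 ![Circle.exp (c w₀ 0), Circle.exp (c w₀ 2)] *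
                  (Matrix.GeneralLinearGroup.mkOfDetNeZero !![(1 : ℂ), 1; 1, -1] det_cayleyTwo_ne_zero)⁻¹,
                cayley_conj_circleDiagonal_mem_of_eq_over hJ _⟩ * h⁻¹ : ↥(unitaryGroupOfForm (starRingEnd ℂ) J)) : GL (Fin 2) ℂ) : Matrix (Fin 2) (Fin 2) ℂ)) ∂μ₀))
        (U ∩ {c | Circle.exp (c w₀ 0) ≠ Circle.exp (c w₀ 2)})) :
    ∃ (K : ℂ) (U : Set ({w : InfinitePlace L // IsComplex w} → Fin 3 → ℝ)) (f : ({w : InfinitePlace L // IsComplex w} → Fin 3 → ℝ) × Matrix (Fin 2) (Fin 2) ℂ → ℂ),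
      K ≠ 0 ∧ IsOpen U ∧ x ∈ U ∧ ContDiff ℝ ∞ f ∧
      (∃ C : Set (Matrix (Fin 2) (Fin 2) ℂ), IsCompact C ∧ ∀ c X, X ∉ C → f (c, X) = 0) ∧
      (∀ c X, f (c, X) = f (Function.update c w₀ ![0, c w₀ 1, 0], X)) ∧
      (∀ c ∈ U, Circle.exp (c w₀ 0) ≠ Circle.exp (c w₀ 2) → c ∈ InRegG (slotSign L α) S) ∧
      ∀ c ∈ U, Circle.exp (c w₀ 0) ≠ Circle.exp (c w₀ 2) →
        orbFamGExt L α ν' a' S c =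
          (1 - (Circle.exp (c w₀ 1 - c w₀ 0) : ℂ)) * (1 - (Circle.exp (c w₀ 2 - c w₀ 0) : ℂ)) * (1 - (Circle.exp (c w₀ 2 - c w₀ 1) : ℂ)) *
          (K * ∫ h : ↥(unitaryGroupOfForm (starRingEnd ℂ) J),
            f (c, (((h * ⟨Matrix.GeneralLinearGroup.mkOfDetNeZero !![(1 : ℂ), 1; 1, -1] det_cayleyTwo_ne_zero *
                  circleDiagonal 2 ![Circle.exp (c w₀ 0), Circle.exp (c w₀ 2)] *
                  (Matrix.GeneralLinearGroup.mkOfDetNeZero !![(1 : ℂ), 1; 1, -1] det_cayleyTwo_ne_zero)⁻¹,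
                cayley_conj_circleDiagonal_mem_of_eq_over hJ _⟩ * h⁻¹ : ↥(unitaryGroupOfForm (starRingEnd ℂ) J)) : GL (Fin 2) ℂ) : Matrix (Fin 2) (Fin 2) ℂ)) ∂μ₀) := by
  -- the off-wall part of the box is open
  have hVo : IsOpen (U ∩ {c : {w : InfinitePlace L // IsComplex w} → Fin 3 → ℝ | Circle.exp (c w₀ 0) ≠ Circle.exp (c w₀ 2)}) :=
    hUo.inter (isOpen_ne_fun (continuous_circleExp_coord w₀ 0) (continuous_circleExp_coord w₀ 2))
  -- the dock: `orbFamGExt = hcExtendG (slotSign L α) S (orbFamG …)` equals the model on `(U ∩ off-wall) ∩ InRegG`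
  have hglue := hcExtendG_eqOn_of_continuousOn (slotSign L α) S (orbFamG L α ν' a' S) hVo hcont
    (fun c hc => hcore c hc.1.1 hc.2)
  refine ⟨K, U, f, hK, hUo, hxU, hf, hfC, hft, hU7, fun c hcU hcw => ?_⟩
  have hcin : c ∈ InRegG (slotSign L α) S := hU7 c hcU hcw
  have h := hglue ⟨⟨hcU, hcw⟩, hcin⟩
  rw [orbFamGExt_apply]
  exact h

omit [MeasurableSpace ↥(arch (↥(maximalRealSubfield L)) L (IsCMField.complexConj L) 3 (Matrix.diagonal α))]
  [BorelSpace ↥(arch (↥(maximalRealSubfield L)) L (IsCMField.complexConj L) 3 (Matrix.diagonal α))] [NumberField L] [IsCMField L] in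
/-- **(F₀) ⊆ (F): a generic (`HcSemireg`) face point satisfies the (B-desc′) base-point hypotheses** (LH7-p04 (g4), signature file). [cite: Bouaziz1994IntegralesOrbitales, §3.2 p. 580] -/
theorem hcSemireg_base_point {S : Finset {w : InfinitePlace L // IsComplex w}} {w₀ : {w : InfinitePlace L // IsComplex w}}
    {x : {w : InfinitePlace L // IsComplex w} → Fin 3 → ℝ} (hp : HcSemireg S w₀ 0 2 x) :
    x w₀ 0 = x w₀ 2 ∧ Circle.exp (x w₀ 1) ≠ Circle.exp (x w₀ 0) ∧
      ∀ w, w ∉ S → w ≠ w₀ → ∀ i j : Fin 3, i ≠ j → slotSign L α w i ≠ slotSign L α w j → Circle.exp (x w i) ≠ Circle.exp (x w j) := by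
  refine ⟨hp.1, ?_, fun w hw hne i j hij _ h => hij (hp.2.2.1 w hw hne h)⟩
  have h2 := hp.2.1
  rw [hcThird_zero_two] at h2
  exact h2


/-- **(B-desc′) FROM THE (H-core) PACKAGE ALONE**: if the RAW member `orbFamG L α ν′ a′ S` admits, around `x`, a box-descent package `(K, U, f)` with the signature's clauses 1–7 and
the descent identity at the `G`-REGULAR points of the box (LH5-p02 (g4)'s (H-core) over ★ (A4′) p851133), then the EXTENDED family `orbFamGExt L α ν′ a′ S` satisfies the
signature's eight clauses — (H-cont) is §3 `continuousOn_boxModel`, the dock is `exists_descent_box_orbFamGExt_inRegG_of_core`.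
[cite: Varadarajan1977, I §1.12] [cite: Rogawski1990, §8.2 pp. 119–124] [cite: Bouaziz1994IntegralesOrbitales, §3.1 (I₁)–(I₂) p. 579] -/
theorem exists_descent_box_orbFamGExt_inRegG_of_corePackage
    {J : Matrix (Fin 2) (Fin 2) ℂ} (hJ : J = (StdForm.antidiagonal 2).over ℂ)
    [MeasurableSpace ↥(unitaryGroupOfForm (starRingEnd ℂ) J)] [BorelSpace ↥(unitaryGroupOfForm (starRingEnd ℂ) J)]
    [LocallyCompactSpace ↥(unitaryGroupOfForm (starRingEnd ℂ) J)] [SecondCountableTopology ↥(unitaryGroupOfForm (starRingEnd ℂ) J)]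
    (μ₀ : Measure ↥(unitaryGroupOfForm (starRingEnd ℂ) J)) [μ₀.IsHaarMeasure] [μ₀.IsMulRightInvariant]
    {S : Finset {w : InfinitePlace L // IsComplex w}} {w₀ : {w : InfinitePlace L // IsComplex w}} {x : {w : InfinitePlace L // IsComplex w} → Fin 3 → ℝ}
    {a' : ↥(arch (↥(maximalRealSubfield L)) L (IsCMField.complexConj L) 3 (Matrix.diagonal α)) → ℂ}
    (hpack : ∃ (K : ℂ) (U : Set ({w : InfinitePlace L // IsComplex w} → Fin 3 → ℝ)) (f : ({w : InfinitePlace L // IsComplex w} → Fin 3 → ℝ) × Matrix (Fin 2) (Fin 2) ℂ → ℂ),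
      K ≠ 0 ∧ IsOpen U ∧ x ∈ U ∧ ContDiff ℝ ∞ f ∧
      (∃ C : Set (Matrix (Fin 2) (Fin 2) ℂ), IsCompact C ∧ ∀ c X, X ∉ C → f (c, X) = 0) ∧
      (∀ c X, f (c, X) = f (Function.update c w₀ ![0, c w₀ 1, 0], X)) ∧
      (∀ c ∈ U, Circle.exp (c w₀ 0) ≠ Circle.exp (c w₀ 2) → c ∈ InRegG (slotSign L α) S) ∧
      ∀ c ∈ U, c ∈ RegG S →
        orbFamG L α ν' a' S c =
          (1 - (Circle.exp (c w₀ 1 - c w₀ 0) : ℂ)) * (1 - (Circle.exp (c w₀ 2 - c w₀ 0) : ℂ)) * (1 - (Circle.exp (c w₀ 2 - c w₀ 1) : ℂ)) *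
          (K * ∫ h : ↥(unitaryGroupOfForm (starRingEnd ℂ) J),
            f (c, (((h * ⟨Matrix.GeneralLinearGroup.mkOfDetNeZero !![(1 : ℂ), 1; 1, -1] det_cayleyTwo_ne_zero *
                  circleDiagonal 2 ![Circle.exp (c w₀ 0), Circle.exp (c w₀ 2)] *
                  (Matrix.GeneralLinearGroup.mkOfDetNeZero !![(1 : ℂ), 1; 1, -1] det_cayleyTwo_ne_zero)⁻¹,
                cayley_conj_circleDiagonal_mem_of_eq_over hJ _⟩ * h⁻¹ : ↥(unitaryGroupOfForm (starRingEnd ℂ) J)) : GL (Fin 2) ℂ) : Matrix (Fin 2) (Fin 2) ℂ)) ∂μ₀)) :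
    ∃ (K : ℂ) (U : Set ({w : InfinitePlace L // IsComplex w} → Fin 3 → ℝ)) (f : ({w : InfinitePlace L // IsComplex w} → Fin 3 → ℝ) × Matrix (Fin 2) (Fin 2) ℂ → ℂ),
      K ≠ 0 ∧ IsOpen U ∧ x ∈ U ∧ ContDiff ℝ ∞ f ∧
      (∃ C : Set (Matrix (Fin 2) (Fin 2) ℂ), IsCompact C ∧ ∀ c X, X ∉ C → f (c, X) = 0) ∧
      (∀ c X, f (c, X) = f (Function.update c w₀ ![0, c w₀ 1, 0], X)) ∧
      (∀ c ∈ U, Circle.exp (c w₀ 0) ≠ Circle.exp (c w₀ 2) → c ∈ InRegG (slotSign L α) S) ∧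
      ∀ c ∈ U, Circle.exp (c w₀ 0) ≠ Circle.exp (c w₀ 2) →
        orbFamGExt L α ν' a' S c =
          (1 - (Circle.exp (c w₀ 1 - c w₀ 0) : ℂ)) * (1 - (Circle.exp (c w₀ 2 - c w₀ 0) : ℂ)) * (1 - (Circle.exp (c w₀ 2 - c w₀ 1) : ℂ)) *
          (K * ∫ h : ↥(unitaryGroupOfForm (starRingEnd ℂ) J),
            f (c, (((h * ⟨Matrix.GeneralLinearGroup.mkOfDetNeZero !![(1 : ℂ), 1; 1, -1] det_cayleyTwo_ne_zero *
                  circleDiagonal 2 ![Circle.exp (c w₀ 0), Circle.exp (c w₀ 2)] *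
                  (Matrix.GeneralLinearGroup.mkOfDetNeZero !![(1 : ℂ), 1; 1, -1] det_cayleyTwo_ne_zero)⁻¹,
                cayley_conj_circleDiagonal_mem_of_eq_over hJ _⟩ * h⁻¹ : ↥(unitaryGroupOfForm (starRingEnd ℂ) J)) : GL (Fin 2) ℂ) : Matrix (Fin 2) (Fin 2) ℂ)) ∂μ₀) := by
  obtain ⟨K, U, f, hK, hUo, hxU, hf, hfC, hft, hU7, hcore⟩ := hpack
  exact exists_descent_box_orbFamGExt_inRegG_of_core L α ν' hJ μ₀ hK hUo hxU hf hfC hft hU7 hcore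
    (continuousOn_boxModel L w₀ hJ μ₀ U f hf hfC K)

end Assembly

end Literature.NumberTheory.Rogawski1990

end
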